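import Mathlib
import Summits.Ventures.PercRepro2.Defs
import Summits.Ventures.PercRepro2.Independence
import Summits.Ventures.PercRepro2.Harris
import Summits.Ventures.PercRepro2.Graph
import Summits.Ventures.PercRepro2.Exploration
import Summits.Ventures.PercRepro2.Events
import Summits.Ventures.PercRepro2.FourFunctions
import Summits.Ventures.PercRepro2.Induced
import Summits.Ventures.PercRepro2.Frontier
import Summits.Ventures.PercRepro2.ObsIndependence
import Summits.Ventures.PercRepro2.BHK
import Summits.Ventures.PercRepro2.BHKEvents
import Summits.Ventures.PercRepro2.SideAgreement
import Summits.Ventures.PercRepro2.VdBKahn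
import Summits.Ventures.PercRepro2.BHKAvoid
import Summits.Ventures.PercRepro2.R2PrimeThreeReduction
import Summits.Ventures.PercRepro2.YBridge
import Summits.Ventures.PercRepro2.Yu1Functionals
import Summits.Ventures.PercRepro2.Yu1Events
import Summits.Ventures.PercRepro2.Yu1
import Summits.Ventures.PercRepro2.LBSplit
import Summits.Ventures.PercRepro2.YDelta
import Summits.Ventures.PercRepro2.SD
import Summits.Ventures.PercRepro2.Threshold
import Summits.Ventures.PercRepro2.Lambda
import Summits.Ventures.PercRepro2.LambdaTau
import Summits.Ventures.PercRepro2.LambdaSlack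
import Summits.Ventures.PercRepro2.HF2
import Summits.Ventures.PercRepro2.Yu2
import Summits.Ventures.PercRepro2.N0
import Summits.Ventures.PercRepro2.Y
import Summits.Ventures.PercRepro2.YDeltaTools
import Summits.Ventures.PercRepro2.ZDelta
import Summits.Ventures.PercRepro2.ZExpand
import Summits.Ventures.PercRepro2.ISplit
import Summits.Ventures.PercRepro2.MRl
import Summits.Ventures.PercRepro2.ZOloc
import Summits.Ventures.PercRepro2.SideBridge
import Summits.Ventures.PercRepro2.HCov
import Summits.Ventures.PercRepro2.BasePrime
import Summits.Ventures.PercRepro2.PendantRoot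
import Summits.Ventures.PercRepro2.PendantO
import Summits.Ventures.PercRepro2.ChordBase
import Summits.Ventures.PercRepro2.CCTRootEdge
import Summits.Ventures.PercRepro2.EdmD

/-!
# Row 2′EDM/D at the leaf edge of a pendant `a₃` (blind cell PercRepro2, typer-1; lead g11
CONJECTURES v2.99e; engine 09:43:44Z "the pendant form is EDM at the `a₃`-leaf edge")

For `a₃` a leaf attached to a root or to `o` by the edge `f`, the closed forms `Gc_pendant_root`
and `Gc_pendant_o` hold at `p` and at `p[f ↦ 0]` alike (the `a₃`-free masses do not see `f`:
`prob_update_of_free`), so row 2′EDM/D at the leaf edge reduces to the sign facts of BHK: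

* **`edmD_pendant_root`**: `EdmD p ends f o a₁ a₂ a₃ b` when `a₃` is a leaf at `a₂`
  (`(1 − q)³ Gc₀ ≤ Gc(p)`, termwise from `C(oL,bL) ≥ 0`, `C(oH,bL) ≤ 0`, `C(oL,bH) ≤ 0`);
* **`edmD_pendant_o`**: `EdmD p ends f o a₁ a₂ a₃ b` when `a₃` is a leaf at `o`
  (`(P − q·moU)² ≤ P²` since `0 ≤ q·moU ≤ P`).
-/

namespace Summit.Ventures.PercRepro2

open UnionCluster CovForm PendantRoot

namespace PendantEdm

variable {V : Type*} {E : Type*} [Fintype E] [DecidableEq E] {R : Type*} [Field R]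
  [LinearOrder R] [IsStrictOrderedRing R]

section Free

variable (p : E → R) {f : E}

omit [LinearOrder R] [IsStrictOrderedRing R] in
/-- A free event has the same probability after pinning `f` (to any value). -/
lemma prob_update_of_free {A : Set (Config E)} (hA : Free f A) (c : R) :
    prob (Function.update p f c) A = prob p A := by
  rw [prob_eq_pin (Function.update p f c) A f, Function.update_idem, Function.update_idem,
    Function.update_self]
  have h1 : prob (Function.update p f 1) A = prob p A := by
    rw [CCT.prob_update_one_eq]
    congr 1
    ext ω
    exact Iff.of_eq (hA fun e he => Function.update_of_ne he true ω)
  have h0 : prob (Function.update p f 0) A = prob p A := by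
    rw [CCT.prob_update_zero_eq]
    congr 1
    ext ω
    exact Iff.of_eq (hA fun e he => Function.update_of_ne he false ω)
  rw [h1, h0]
  ring

end Free

section Root

variable [Fintype V] [DecidableEq V] (p : E → R) (ends : E → Sym2 V)

/-- **2′EDM/D at the leaf edge, `a₃` a leaf at the root `a₂`.** -/
theorem edmD_pendant_root (hp : IsProbVec p) {f : E} {a₃ a₂ : V} (hf : ends f = s(a₃, a₂))
    (hleaf : ∀ e, a₃ ∈ ends e → e = f) (h32 : a₃ ≠ a₂) {o a₁ b : V} (h31 : a₃ ≠ a₁)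
    (ho : o ≠ a₃) (hb : b ≠ a₃) : EdmRow.EdmD p ends f o a₁ a₂ a₃ b := by
  unfold EdmRow.EdmD
  have hp₀ : IsProbVec (Function.update p f 0) := hp.update f le_rfl zero_le_one
  -- the closed forms at `p` and at `p[f ↦ 0]`
  have hG := Gc_pendant_root p ends hf hleaf h32 h31 ho hb
  have hG₀ := Gc_pendant_root (Function.update p f 0) ends hf hleaf h32 h31 ho hb
  -- `D = (1 − q) P(Q)` at `p`, `D₀ = P(Q)` at `p[f ↦ 0]`, and the free masses agree
  have hD := prob_PD p hf hleaf h32 h31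
  have hD₀ := prob_PD (Function.update p f 0) hf hleaf h32 h31
  have hQfree : Free f (avoidAll ends a₂ {a₁}) := free_avoidAll hf hleaf h32 h31
  have c₁o := free_connEvent hf hleaf h32 (Ne.symm h31) ho
  have c₂o := free_connEvent hf hleaf h32 (Ne.symm h32) ho
  have c₁b := free_connEvent hf hleaf h32 (Ne.symm h31) hb
  have c₂b := free_connEvent hf hleaf h32 (Ne.symm h32) hb
  simp only [Function.update_self] at hG₀ hD₀
  unfold covC at hG hG₀
  simp only [prob_update_of_free p hQfree, prob_update_of_free p (hQfree.inter c₁o),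
    prob_update_of_free p (hQfree.inter c₂o), prob_update_of_free p (hQfree.inter c₁b),
    prob_update_of_free p (hQfree.inter c₂b), prob_update_of_free p (hQfree.inter (c₁o.inter c₁b)),
    prob_update_of_free p (hQfree.inter (c₂o.inter c₁b)),
    prob_update_of_free p (hQfree.inter (c₁o.inter c₂b))] at hG₀ hD₀
  rw [hG, hG₀, hD, hD₀, prob_update_of_free p hQfree]
  -- the sign facts
  have h1 := covC_same_nonneg p ends hp o a₁ a₂ b
  obtain ⟨h2, h3⟩ := covC_cross_nonpos p ends hp o a₁ a₂ b
  unfold covC at h1 h2 h3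
  have hq0 := hp.nonneg f
  have hq1 := sub_nonneg.2 (hp.le_one f)
  have hQ := prob_nonneg hp (avoidAll ends a₂ {a₁})
  set q := p f
  set P := prob p (avoidAll ends a₂ {a₁})
  set Cll := P * prob p (avoidAll ends a₂ {a₁} ∩ (connEvent ends a₁ o ∩ connEvent ends a₁ b)) -
    prob p (avoidAll ends a₂ {a₁} ∩ connEvent ends a₁ o) *
      prob p (avoidAll ends a₂ {a₁} ∩ connEvent ends a₁ b)
  set Chl := P * prob p (avoidAll ends a₂ {a₁} ∩ (connEvent ends a₂ o ∩ connEvent ends a₁ b)) -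
    prob p (avoidAll ends a₂ {a₁} ∩ connEvent ends a₂ o) *
      prob p (avoidAll ends a₂ {a₁} ∩ connEvent ends a₁ b)
  set Clh := P * prob p (avoidAll ends a₂ {a₁} ∩ (connEvent ends a₁ o ∩ connEvent ends a₂ b)) -
    prob p (avoidAll ends a₂ {a₁} ∩ connEvent ends a₁ o) *
      prob p (avoidAll ends a₂ {a₁} ∩ connEvent ends a₂ b)
  -- `(1 − q)³ · Gc₀ ≤ Gc(p)` termwise, times `P³ ≥ 0`
  have key : 0 ≤ (1 - q) * P * (2 * q * Cll - 2 * (1 - q) * Chl - 2 * Clh) -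
      (1 - q) ^ 3 * (P * (2 * 0 * Cll - 2 * (1 - 0) * Chl - 2 * Clh)) := by
    have e1 : (1 - q) * P * (2 * q * Cll - 2 * (1 - q) * Chl - 2 * Clh) -
        (1 - q) ^ 3 * (P * (2 * 0 * Cll - 2 * (1 - 0) * Chl - 2 * Clh)) =
        (1 - q) * P * (2 * q * Cll + 2 * q * (1 - q) * (-Chl) + 2 * q * (2 - q) * (-Clh)) := by
      ring
    rw [e1]
    refine mul_nonneg (mul_nonneg hq1 hQ) ?_
    have h2q : (0 : R) ≤ 2 - q := by linarith
    have t1 := mul_nonneg (mul_nonneg (by norm_num : (0 : R) ≤ 2) hq0) h1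
    have t2 := mul_nonneg (mul_nonneg (mul_nonneg (by norm_num : (0 : R) ≤ 2) hq0) hq1)
      (neg_nonneg.2 h2)
    have t3 := mul_nonneg (mul_nonneg (mul_nonneg (by norm_num : (0 : R) ≤ 2) hq0) h2q)
      (neg_nonneg.2 h3)
    linarith
  have hP3 : 0 ≤ P ^ 3 := pow_nonneg hQ 3
  nlinarith [mul_nonneg key hP3]

end Root

section O

variable [Fintype V] [DecidableEq V] (p : E → R) (ends : E → Sym2 V)

/-- **2′EDM/D at the leaf edge, `a₃` a leaf at `o`.** -/
theorem edmD_pendant_o (hp : IsProbVec p) {f : E} {a₃ o : V} (hf : ends f = s(a₃, o))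
    (hleaf : ∀ e, a₃ ∈ ends e → e = f) (h3o : a₃ ≠ o) {a₁ a₂ b : V} (h31 : a₃ ≠ a₁)
    (h32 : a₃ ≠ a₂) (hb : b ≠ a₃) : EdmRow.EdmD p ends f o a₁ a₂ a₃ b := by
  unfold EdmRow.EdmD
  have hG := PendantO.Gc_pendant_o p ends hf hleaf h3o h31 h32 hb
  have hG₀ := PendantO.Gc_pendant_o (Function.update p f 0) ends hf hleaf h3o h31 h32 hb
  have hD := PendantO.prob_PD_o p hf hleaf h3o h31 h32
  have hD₀ := PendantO.prob_PD_o (Function.update p f 0) hf hleaf h3o h31 h32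
  have hQfree : Free f (avoidAll ends a₂ {a₁}) := PendantO.free_Q hf hleaf h3o h31 h32
  have c₁o := free_connEvent hf hleaf h3o (Ne.symm h31) (Ne.symm h3o)
  have c₂o := free_connEvent hf hleaf h3o (Ne.symm h32) (Ne.symm h3o)
  have c₁b := free_connEvent hf hleaf h3o (Ne.symm h31) hb
  have c₂b := free_connEvent hf hleaf h3o (Ne.symm h32) hb
  simp only [Function.update_self] at hG₀ hD₀
  unfold covC at hG hG₀
  simp only [prob_update_of_free p hQfree, prob_update_of_free p (hQfree.inter c₁o),
    prob_update_of_free p (hQfree.inter c₂o), prob_update_of_free p (hQfree.inter c₁b),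
    prob_update_of_free p (hQfree.inter c₂b),
    prob_update_of_free p (hQfree.inter (c₂o.inter c₁b)),
    prob_update_of_free p (hQfree.inter (c₁o.inter c₂b))] at hG₀ hD₀
  rw [hG, hG₀, hD, hD₀, prob_update_of_free p hQfree]
  obtain ⟨h2, h3⟩ := covC_cross_nonpos p ends hp o a₁ a₂ b
  unfold covC at h2 h3
  have hq0 := hp.nonneg f
  have hq1 := sub_nonneg.2 (hp.le_one f)
  have hQ := prob_nonneg hp (avoidAll ends a₂ {a₁})
  -- `q · moU ≤ P`: `o ∈ C₁` and `o ∈ C₂` are disjoint under `Q`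
  have hmoU : prob p (avoidAll ends a₂ {a₁} ∩ connEvent ends a₁ o) +
      prob p (avoidAll ends a₂ {a₁} ∩ connEvent ends a₂ o) ≤ prob p (avoidAll ends a₂ {a₁}) := by
    have hu := prob_union_add_prob_inter p (avoidAll ends a₂ {a₁} ∩ connEvent ends a₁ o)
      (avoidAll ends a₂ {a₁} ∩ connEvent ends a₂ o)
    have hint : avoidAll ends a₂ {a₁} ∩ connEvent ends a₁ o ∩
        (avoidAll ends a₂ {a₁} ∩ connEvent ends a₂ o) = ∅ := by
      have := PendantO.Q_inter_both_eq_empty ends a₁ a₂ o Set.univ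
      rw [Set.inter_univ] at this
      rw [← this]
      ext ω; simp only [Set.mem_inter_iff]; tauto
    rw [hint, prob_empty, add_zero] at hu
    have hsub := prob_mono hp (show avoidAll ends a₂ {a₁} ∩ connEvent ends a₁ o ∪
        avoidAll ends a₂ {a₁} ∩ connEvent ends a₂ o ⊆ avoidAll ends a₂ {a₁} from
      Set.union_subset Set.inter_subset_left Set.inter_subset_left)
    linarith
  have h1o := prob_nonneg hp (avoidAll ends a₂ {a₁} ∩ connEvent ends a₁ o)
  have h2o := prob_nonneg hp (avoidAll ends a₂ {a₁} ∩ connEvent ends a₂ o)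
  set q := p f
  set P := prob p (avoidAll ends a₂ {a₁})
  set oL := prob p (avoidAll ends a₂ {a₁} ∩ connEvent ends a₁ o)
  set oH := prob p (avoidAll ends a₂ {a₁} ∩ connEvent ends a₂ o)
  set X := P * prob p (avoidAll ends a₂ {a₁} ∩ (connEvent ends a₂ o ∩ connEvent ends a₁ b)) -
      oH * prob p (avoidAll ends a₂ {a₁} ∩ connEvent ends a₁ b) +
    (P * prob p (avoidAll ends a₂ {a₁} ∩ (connEvent ends a₁ o ∩ connEvent ends a₂ b)) -
      oL * prob p (avoidAll ends a₂ {a₁} ∩ connEvent ends a₂ b))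
  have hX : X ≤ 0 := by linarith
  -- `D = P − q·(oL + oH)` with `0 ≤ q (oL + oH) ≤ P`
  have hD1 : 0 ≤ P - q * oL - q * oH := by nlinarith [mul_le_mul_of_nonneg_left hmoU hq0]
  have hD2 : P - q * oL - q * oH ≤ P := by nlinarith
  -- `(1−q)·(−2 P X)·[(P − q moU)² − P²] ≤ 0`
  have hsq : (P - q * oL - q * oH) ^ 2 ≤ P ^ 2 := pow_le_pow_left₀ hD1 hD2 2
  have hfac : 0 ≤ (1 - q) * (-2 * P * X) := by
    have : 0 ≤ -2 * P * X := by nlinarith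
    exact mul_nonneg hq1 this
  nlinarith [mul_le_mul_of_nonneg_left hsq hfac]

end O

end PendantEdm

end Summit.Ventures.PercRepro2
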